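import Summits.RiemannHypothesis.RiemannHypothesis.Theorems.WeilWindowFlowDiniLeakageStubRelCommutatorBoundAux
import Summits.RiemannHypothesis.RiemannHypothesis.Theorems.WeilWindowFlowWindowLipschitzStubSupBound
import Summits.RiemannHypothesis.RiemannHypothesis.Theorems.WeilWindowFlowWindowLipschitzStubEulerLagrange
import Summits.RiemannHypothesis.RiemannHypothesis.Theorems.WeilWindowFlowWindowLipschitzStubFormDomainPos
import Summits.RiemannHypothesis.RiemannHypothesis.Theorems.WeilWindowFlowWindowLipschitzStubGroundStateEnergy

/-!
# Stub `stub_relCommutatorBound` (E♭) for crux `WeilWindowFlow.DiniLeakage`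
(item stmt-RiemannHypothesis-1038; line skeleton `collar-cut-edge-mass`,
`Summits/RiemannHypothesis/RiemannHypothesis/Cruxes/DiniLeakage/Lines/collar_cut_edge_mass.lean`)

**What is proved.** GIVEN the relative `L²` edge-mass law of ground states on compact window
ranges (`∫_{a−r<|x|} |u|² ≤ (K ε(a) + η) r / log(1/r)` for `r ≤ r₀(η)`, the hypothesis), for every
range `[b₀, A]` there is `K' = 128 K` such that for every slack `η > 0` there is a width `h₀ > 0`
with: for every window `a ∈ [b₀, A]`, width `0 < h ≤ h₀`, ground state `u` and admissible cutoff
`χ`, the right-hand side of the localised cut inequality (archimedean + prime commutators + polar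
remainder) is `≤ h (K' ε(a) + η)` and `∫ |χ u|² ≥ 1/2`.

**Proof.** The uniform sup bound (A) is the landed theorem `stub_supBound` fed with the landed
(C2) `stub_groundStateEnergy` and (EL) `stub_eulerLagrange stub_formDomainPos stub_groundStateEnergy`.
Normalise `u` (`stub_commutatorBound_normalise`), put `η₁ = η/512`, `κ = K ε(a) + 2η₁ > 0`
(`K ε(a) + η₁ ≥ 0` by the law at `r = d₀`), `κ ≤ K_BM = K max(ε(b₀), 0) + 2η₁` (antitonicity of
`ε`), and apply the `κ`-homogeneous core `stub_relCommutatorBound_core`: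
`RHS ≤ 128 κ h + κ h (96/log(1/(6h)) + 16/√J + 32M²/J) + √κ h/√J · P`.  For `h ≤ h₀(η)` the
dyadic index satisfies `J > N = ⌈1/τ²⌉`, `log(1/(6h)) ≥ 1/τ`, so the error terms are
`≤ τ h (K_BM (112 + 32 M²) + (K_BM + 1) P) ≤ (η/2) h`, while `128 κ h = 128 K ε(a) h + (η/2) h`.

Sources: line card `Lines/collar-cut-edge-mass.md` §Stub E♭; Cycon–Froese–Kirsch–Simon,
*Schrödinger Operators*, Thm 3.2 (IMS localisation).
-/

set_option linter.dupNamespace false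

noncomputable section

open MeasureTheory Set Filter
open scoped Topology ENNReal NNReal

namespace Summit.RiemannHypothesis.RiemannHypothesis.Theorems.WeilWindowFlowDiniLeakage

open Literature.NumberTheory.LFunctions
open Summit.RiemannHypothesis.RiemannHypothesis.Theorems.WeilWindowFlowWindowLipschitz

/-- **Stub E♭ `stub_relCommutatorBound` — the relative commutator bound** (verbatim registered
statement of line `collar-cut-edge-mass`). See the module docstring. -/
theorem stub_relCommutatorBound :
    (∀ b₀ A : ℝ, 0 < b₀ → b₀ ≤ A → ∃ K : ℝ, 0 ≤ K ∧ ∀ η : ℝ, 0 < η → ∃ r₀ : ℝ, 0 < r₀ ∧ r₀ < 1 ∧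
      ∀ (a r : ℝ) (u : ℝ → ℂ), b₀ ≤ a → a ≤ A → IsWeilGroundState a u → 0 < r → r ≤ r₀ →
        ∫ x in {x : ℝ | a - r < |x|}, ‖u x‖ ^ 2 ≤
          (K * weilGroundEnergy a + η) * r / Real.log (1 / r)) →
    ∀ b₀ A : ℝ, 0 < b₀ → b₀ ≤ A → ∃ K : ℝ, 0 ≤ K ∧ ∀ η : ℝ, 0 < η → ∃ h₀ : ℝ, 0 < h₀ ∧
        ∀ (a h : ℝ) (u : ℝ → ℂ) (χ : ℝ → ℝ), b₀ ≤ a → a ≤ A → 0 < h → h ≤ h₀ →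
        IsWeilGroundState a u → (∀ x y, |χ x - χ y| ≤ |x - y| / h) → (∀ x, 0 ≤ χ x ∧ χ x ≤ 1) →
        (∀ x, |x| ≤ a - 2 * h → χ x = 1) → (∀ x, a - h ≤ |x| → χ x = 0) →
        (∫ t in Ioi (0 : ℝ), weilArchDensity t *
              ∫ x, (χ (x + t) - χ x) ^ 2 * (‖u (x + t)‖ * ‖u x‖)) +
          (∑ n ∈ weilPrimeIndex a, (ArithmeticFunction.vonMangoldt n : ℝ) / Real.sqrt n *
              ∫ x, (χ (x + Real.log n) - χ x) ^ 2 * (‖u (x + Real.log n)‖ * ‖u x‖)) +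
          2 * ‖∫ t, ((1 - χ t : ℝ) : ℂ) * u t * (Real.cosh (t / 2) : ℂ)‖ ^ 2 +
          2 * ‖∫ t, u t * (Real.cosh (t / 2) : ℂ)‖ *
              ‖∫ t, (((1 - χ t) ^ 2 : ℝ) : ℂ) * u t * (Real.cosh (t / 2) : ℂ)‖ +
          2 * ‖∫ t, u t * (Real.sinh (t / 2) : ℂ)‖ *
              ‖∫ t, (((1 - χ t) ^ 2 : ℝ) : ℂ) * u t * (Real.sinh (t / 2) : ℂ)‖ ≤
            h * (K * weilGroundEnergy a + η) ∧
          1 / 2 ≤ ∫ x, ‖(χ x : ℂ) * u x‖ ^ 2 := by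
  intro hB b₀ A hb₀ hbA
  obtain ⟨KA, hKA⟩ := stub_supBound stub_groundStateEnergy
    (stub_eulerLagrange stub_formDomainPos stub_groundStateEnergy) b₀ A hb₀ hbA
  obtain ⟨K, hK0, hKη⟩ := hB b₀ A hb₀ hbA
  have hA0 : 0 < A := hb₀.trans_le hbA
  refine ⟨128 * K, by positivity, fun η hη ↦ ?_⟩
  -- the slack `η₁ = η/512` and the edge-mass radius `d₀ = min r₀ (1/4)`
  obtain ⟨r₀, hr₀, hr₀1, hB1⟩ := hKη (η / 512) (by positivity)
  obtain ⟨d₀, hd₀def⟩ : ∃ d₀ : ℝ, d₀ = min r₀ (1 / 4) := ⟨_, rfl⟩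
  have hd₀ : 0 < d₀ := by rw [hd₀def]; exact lt_min hr₀ (by norm_num)
  have hd₀4 : d₀ ≤ 1 / 4 := by rw [hd₀def]; exact min_le_right _ _
  have hd₀r : d₀ ≤ r₀ := by rw [hd₀def]; exact min_le_left _ _
  -- uniform constants: `K_BM ≥ κ`, the prime sum `S_A`, the error coefficient `E`
  obtain ⟨KBM, hKBMdef⟩ : ∃ x : ℝ, x = K * max (weilGroundEnergy b₀) 0 + 2 * (η / 512) := ⟨_, rfl⟩
  have hKBM0 : 0 ≤ KBM := by rw [hKBMdef]; positivity
  obtain ⟨SA, hSAdef⟩ : ∃ x : ℝ,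
      x = ∑ n ∈ weilPrimeIndex A, (ArithmeticFunction.vonMangoldt n : ℝ) / Real.sqrt n := ⟨_, rfl⟩
  have hSA0 : 0 ≤ SA := by
    rw [hSAdef]
    exact Finset.sum_nonneg fun n _ ↦
      div_nonneg ArithmeticFunction.vonMangoldt_nonneg (Real.sqrt_nonneg _)
  have hρ8 : 0 < weilArchDensity (d₀ / 8) := weilArchDensity_pos (by positivity)
  obtain ⟨P, hPdef⟩ : ∃ x : ℝ, x = 8 * weilArchDensity (d₀ / 8) * (A + 1 / 2) +
      8 * SA * max KA 0 + 16 * Real.cosh (A / 2) ^ 2 * (A + 1 / 2) := ⟨_, rfl⟩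
  have hP0 : 0 ≤ P := by rw [hPdef]; positivity
  obtain ⟨E, hEdef⟩ : ∃ x : ℝ, x = KBM * (112 + 32 * Real.cosh (A / 2) ^ 2) + (KBM + 1) * P :=
    ⟨_, rfl⟩
  have hE0 : 0 ≤ E := by rw [hEdef]; positivity
  -- the smallness scale `τ`, the dyadic depth `N`, the width `h₀`
  obtain ⟨τ, hτdef⟩ : ∃ x : ℝ, x = min 1 (η / 2 / (E + 1)) := ⟨_, rfl⟩
  have hτ : 0 < τ := by rw [hτdef]; positivity
  have hτ1 : τ ≤ 1 := by rw [hτdef]; exact min_le_left _ _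
  have hτE : τ * (E + 1) ≤ η / 2 := by
    have : τ ≤ η / 2 / (E + 1) := by rw [hτdef]; exact min_le_right _ _
    rwa [le_div_iff₀ (by positivity)] at this
  obtain ⟨N, hNdef⟩ : ∃ n : ℕ, n = ⌈1 / τ ^ 2⌉₊ := ⟨_, rfl⟩
  obtain ⟨h₀, hh₀def⟩ : ∃ x : ℝ, x = min (d₀ / 16) (min (d₀ / (4 * 2 ^ (N + 1)))
      (min (1 / (6 * Real.exp (1 / τ))) (1 / (4 * (KBM + 1))))) := ⟨_, rfl⟩
  have hh₀ : 0 < h₀ := by rw [hh₀def]; positivity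
  refine ⟨h₀, hh₀, ?_⟩
  intro a h u χ hba haA hh hhh₀ hu hχlip hχ01 hχ1 _hχ0
  -- smallness of `h`
  rw [hh₀def] at hhh₀
  have hh16 : h ≤ d₀ / 16 := hhh₀.trans (min_le_left _ _)
  have hhN : h ≤ d₀ / (4 * 2 ^ (N + 1)) :=
    hhh₀.trans ((min_le_right _ _).trans (min_le_left _ _))
  have hhexp : h ≤ 1 / (6 * Real.exp (1 / τ)) :=
    hhh₀.trans ((min_le_right _ _).trans ((min_le_right _ _).trans (min_le_left _ _)))
  have hhK : h ≤ 1 / (4 * (KBM + 1)) :=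
    hhh₀.trans ((min_le_right _ _).trans ((min_le_right _ _).trans (min_le_right _ _)))
  have hhd : 16 * h ≤ d₀ := by linarith
  -- normalise `u`
  obtain ⟨v, hvm, hvu, hv0, hvb⟩ := stub_commutatorBound_normalise hu (hKA a u hba haA hu)
  have hgs : IsWeilGroundState a v := hu.congr_ae hvu.symm
  -- the relative edge-mass constant `κ = K ε(a) + 2η₁ > 0`, `κ ≤ K_BM`
  have hKε : 0 ≤ K * weilGroundEnergy a + η / 512 := by
    have hint := hB1 a d₀ u hba haA hu hd₀ hd₀r
    have hnn : 0 ≤ ∫ x in {x : ℝ | a - d₀ < |x|}, ‖u x‖ ^ 2 :=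
      integral_nonneg fun _ ↦ by positivity
    have hlog : 0 < Real.log (1 / d₀) := Real.log_pos (by rw [lt_div_iff₀ hd₀]; linarith)
    by_contra hneg
    have : (K * weilGroundEnergy a + η / 512) * d₀ / Real.log (1 / d₀) < 0 :=
      div_neg_of_neg_of_pos (mul_neg_of_neg_of_pos (not_le.1 hneg) hd₀) hlog
    linarith
  obtain ⟨κ, hκdef⟩ : ∃ x : ℝ, x = K * weilGroundEnergy a + 2 * (η / 512) := ⟨_, rfl⟩
  have hκ : 0 < κ := by rw [hκdef]; linarith
  have hκM : κ ≤ KBM := by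
    have hεle : weilGroundEnergy a ≤ max (weilGroundEnergy b₀) 0 :=
      (stub_supBound_weilGroundEnergy_anti hb₀ hba).trans (le_max_left _ _)
    have := mul_le_mul_of_nonneg_left hεle hK0
    rw [hκdef, hKBMdef]
    linarith
  -- the edge-mass law for `v` with constant `κ` on `(0, d₀]`
  have hBv : ∀ r, 0 < r → r ≤ d₀ →
      ∫ x in {x | a - r < |x|}, ‖v x‖ ^ 2 ≤ κ * r / Real.log (1 / r) := by
    intro r hr hrd
    have heq : ∫ x in {x | a - r < |x|}, ‖v x‖ ^ 2 = ∫ x in {x | a - r < |x|}, ‖u x‖ ^ 2 :=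
      integral_congr_ae (ae_restrict_of_ae (hvu.mono fun x hx ↦ by simp only [hx]))
    rw [heq]
    have hlog : 0 < Real.log (1 / r) := Real.log_pos (by
      rw [lt_div_iff₀ hr]; linarith [hrd.trans hd₀4])
    calc _ ≤ (K * weilGroundEnergy a + η / 512) * r / Real.log (1 / r) :=
          hB1 a r u hba haA hu hr (hrd.trans hd₀r)
      _ ≤ κ * r / Real.log (1 / r) := by
          refine div_le_div_of_nonneg_right (mul_le_mul_of_nonneg_right ?_ hr.le) hlog.le
          rw [hκdef]
          linarith
  have hSA : ∑ n ∈ weilPrimeIndex a, (ArithmeticFunction.vonMangoldt n : ℝ) / Real.sqrt n ≤ SA := by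
    rw [hSAdef]
    exact Finset.sum_le_sum_of_subset_of_nonneg (stub_supBound_weilPrimeIndex_mono haA)
      (fun n _ _ ↦ div_nonneg ArithmeticFunction.vonMangoldt_nonneg (Real.sqrt_nonneg _))
  -- the dyadic index `J > N`, so `1/√J ≤ τ` and `1/J ≤ τ`; also `1/log(1/(6h)) ≤ τ`, `4κh ≤ 1`
  obtain ⟨J, hJ1, hJ2⟩ := exists_nat_pow_near (x := d₀ / (4 * h)) (y := (2 : ℝ))
    (by rw [le_div_iff₀ (by positivity)]; linarith) one_lt_two
  have hNJ : N < J := by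
    have h1 : (2 : ℝ) ^ (N + 1) ≤ d₀ / (4 * h) := by
      rw [le_div_iff₀ (by positivity)]
      have := hhN
      rw [le_div_iff₀ (by positivity)] at this
      linarith
    have h2 := (pow_lt_pow_iff_right₀ (one_lt_two : (1 : ℝ) < 2)).1 (h1.trans_lt hJ2)
    omega
  have hJτ : 1 / τ ^ 2 ≤ (J : ℝ) :=
    calc 1 / τ ^ 2 ≤ (N : ℝ) := by rw [hNdef]; exact Nat.le_ceil _
      _ ≤ J := by exact_mod_cast hNJ.le
  have hJpos : (0 : ℝ) < J := lt_of_lt_of_le (by positivity) hJτ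
  have hsqJpos : 0 < Real.sqrt J := Real.sqrt_pos.2 hJpos
  have hsqJ : 1 / τ ≤ Real.sqrt J := by
    rw [Real.le_sqrt (by positivity) hJpos.le, div_pow, one_pow]
    exact hJτ
  have hτa : 1 / Real.sqrt J ≤ τ := by rwa [one_div_le hsqJpos hτ]
  have hτb : 1 / (J : ℝ) ≤ τ := by
    have h1 : 1 / (J : ℝ) ≤ τ ^ 2 := by rwa [one_div_le hJpos (by positivity)]
    exact h1.trans (pow_le_of_le_one hτ.le hτ1 two_ne_zero)
  have hτc : 1 / Real.log (1 / (6 * h)) ≤ τ := by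
    have hexp : Real.exp (1 / τ) ≤ 1 / (6 * h) := by
      rw [le_div_iff₀ (by positivity)]
      have := hhexp
      rw [le_div_iff₀ (by positivity)] at this
      linarith
    have hlog : 1 / τ ≤ Real.log (1 / (6 * h)) := (Real.le_log_iff_exp_le (by positivity)).2 hexp
    have hlogpos : 0 < Real.log (1 / (6 * h)) := lt_of_lt_of_le (by positivity) hlog
    rwa [one_div_le hlogpos hτ]
  have h4κ : 4 * κ * h ≤ 1 := by
    have h1 : 4 * (KBM + 1) * h ≤ 1 := by
      have := hhK
      rw [le_div_iff₀ (by positivity)] at this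
      linarith
    have h2 := mul_le_mul_of_nonneg_right (show 4 * κ ≤ 4 * (KBM + 1) by linarith) hh.le
    linarith
  -- the core bound for `v`
  have hcore := stub_relCommutatorBound_core hvm hgs hv0 hvb hκ hd₀ hd₀4 hBv haA hSA hh hhd h4κ
    hJ1 hJ2 hχlip hχ01 hχ1
  -- transport the six integrals from `v` back to `u`
  have hsh : ∀ s : ℝ, (fun x ↦ v (x + s)) =ᵐ[volume] fun x ↦ u (x + s) := fun s ↦
    (measurePreserving_add_right volume s).quasiMeasurePreserving.ae_eq_comp hvu
  have e1 : ∀ s : ℝ, ∫ x, (χ (x + s) - χ x) ^ 2 * (‖v (x + s)‖ * ‖v x‖) =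
      ∫ x, (χ (x + s) - χ x) ^ 2 * (‖u (x + s)‖ * ‖u x‖) := by
    intro s
    refine integral_congr_ae ?_
    filter_upwards [hvu, hsh s] with x hx hxs
    simp only [hx, hxs]
  have e3 : ∀ w : ℝ → ℂ, ∫ t, w t * v t * (Real.cosh (t / 2) : ℂ) =
      ∫ t, w t * u t * (Real.cosh (t / 2) : ℂ) := fun w ↦
    integral_congr_ae (hvu.mono fun x hx ↦ by simp only [hx])
  have e4 : ∀ w : ℝ → ℂ, ∫ t, w t * v t * (Real.sinh (t / 2) : ℂ) =
      ∫ t, w t * u t * (Real.sinh (t / 2) : ℂ) := fun w ↦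
    integral_congr_ae (hvu.mono fun x hx ↦ by simp only [hx])
  have e5 : ∫ t, v t * (Real.cosh (t / 2) : ℂ) = ∫ t, u t * (Real.cosh (t / 2) : ℂ) :=
    integral_congr_ae (hvu.mono fun x hx ↦ by simp only [hx])
  have e6 : ∫ t, v t * (Real.sinh (t / 2) : ℂ) = ∫ t, u t * (Real.sinh (t / 2) : ℂ) :=
    integral_congr_ae (hvu.mono fun x hx ↦ by simp only [hx])
  have e7 : ∫ x, ‖(χ x : ℂ) * v x‖ ^ 2 = ∫ x, ‖(χ x : ℂ) * u x‖ ^ 2 :=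
    integral_congr_ae (hvu.mono fun x hx ↦ by simp only [hx])
  simp only [e1, e3, e4, e5, e6, e7] at hcore
  obtain ⟨hc1, hc2⟩ := hcore
  refine ⟨hc1.trans ?_, hc2⟩
  rw [← hPdef]
  -- the final numerical inequality
  have hsqrtκ : Real.sqrt κ ≤ KBM + 1 := by
    have h1 : Real.sqrt κ ≤ κ + 1 := by
      nlinarith only [Real.sq_sqrt hκ.le, Real.sqrt_nonneg κ, sq_nonneg (Real.sqrt κ - 1 / 2)]
    linarith
  have hX1 : κ * h * (96 / Real.log (1 / (6 * h)) + 16 / Real.sqrt J +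
      32 * Real.cosh (A / 2) ^ 2 / J) ≤ τ * h * (KBM * (112 + 32 * Real.cosh (A / 2) ^ 2)) := by
    have h96 : 96 / Real.log (1 / (6 * h)) ≤ 96 * τ :=
      calc 96 / Real.log (1 / (6 * h)) = 96 * (1 / Real.log (1 / (6 * h))) := by ring
        _ ≤ 96 * τ := mul_le_mul_of_nonneg_left hτc (by norm_num)
    have h16 : 16 / Real.sqrt J ≤ 16 * τ :=
      calc 16 / Real.sqrt J = 16 * (1 / Real.sqrt J) := by ring
        _ ≤ 16 * τ := mul_le_mul_of_nonneg_left hτa (by norm_num)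
    have h32 : 32 * Real.cosh (A / 2) ^ 2 / J ≤ 32 * Real.cosh (A / 2) ^ 2 * τ :=
      calc 32 * Real.cosh (A / 2) ^ 2 / J = 32 * Real.cosh (A / 2) ^ 2 * (1 / J) := by ring
        _ ≤ 32 * Real.cosh (A / 2) ^ 2 * τ := mul_le_mul_of_nonneg_left hτb (by positivity)
    have hsum : 96 / Real.log (1 / (6 * h)) + 16 / Real.sqrt J + 32 * Real.cosh (A / 2) ^ 2 / J ≤
        τ * (112 + 32 * Real.cosh (A / 2) ^ 2) := by linarith
    calc κ * h * (96 / Real.log (1 / (6 * h)) + 16 / Real.sqrt J + 32 * Real.cosh (A / 2) ^ 2 / J)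
        ≤ κ * h * (τ * (112 + 32 * Real.cosh (A / 2) ^ 2)) :=
          mul_le_mul_of_nonneg_left hsum (by positivity)
      _ ≤ KBM * h * (τ * (112 + 32 * Real.cosh (A / 2) ^ 2)) :=
          mul_le_mul_of_nonneg_right (mul_le_mul_of_nonneg_right hκM hh.le) (by positivity)
      _ = τ * h * (KBM * (112 + 32 * Real.cosh (A / 2) ^ 2)) := by ring
  have hX2 : Real.sqrt κ * h / Real.sqrt J * P ≤ τ * h * ((KBM + 1) * P) := by
    have h1 : Real.sqrt κ * h / Real.sqrt J = Real.sqrt κ * h * (1 / Real.sqrt J) := by ring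
    rw [h1]
    calc Real.sqrt κ * h * (1 / Real.sqrt J) * P ≤ (KBM + 1) * h * τ * P := by
          refine mul_le_mul_of_nonneg_right ?_ hP0
          exact mul_le_mul (mul_le_mul_of_nonneg_right hsqrtκ hh.le) hτa (by positivity)
            (by positivity)
      _ = τ * h * ((KBM + 1) * P) := by ring
  have hmain : 128 * κ * h = 128 * K * weilGroundEnergy a * h + η / 2 * h := by
    rw [hκdef]; ring
  have herr : τ * h * (KBM * (112 + 32 * Real.cosh (A / 2) ^ 2)) + τ * h * ((KBM + 1) * P) ≤
      η / 2 * h := by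
    have heq : τ * h * (KBM * (112 + 32 * Real.cosh (A / 2) ^ 2)) + τ * h * ((KBM + 1) * P) =
        h * (τ * E) := by
      rw [hEdef]; ring
    rw [heq]
    have hτE' : τ * E ≤ η / 2 :=
      (mul_le_mul_of_nonneg_left (by linarith : E ≤ E + 1) hτ.le).trans hτE
    calc h * (τ * E) ≤ h * (η / 2) := mul_le_mul_of_nonneg_left hτE' hh.le
      _ = η / 2 * h := by ring
  linarith

end Summit.RiemannHypothesis.RiemannHypothesis.Theorems.WeilWindowFlowDiniLeakage

end
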